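import Summits.ABC.IUTFork.Joshi.ArithmeticoidsNumberFieldModel
import Summits.ABC.IUTFork.Joshi.Arithmeticoids2
import Summits.ABC.IUTFork.Joshi.ArithmeticoidFrobenioids
import Mathlib.Topology.Instances.ZMod
import HarnessLib

/-!
# The [J-2½] §4.5 / §5 tower signatures (`BRingDatum`, `ResidueDatum`, `TiltDatum`) INSTANTIATED over the arithmetic model
# `NumberFieldModel.model L` of `DeformationDatum` (block E, rung LADDER-ABC:A2.E, seat E-t48; hand-over of E-t46 09:41:51Z)

Proof-side sequel of `Joshi/ArithmeticoidsNumberFieldModel.lean` (p434710: for every number field `L`, ALL places, Artin–Whaples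
absolute values, Mathlib's product formula). Seat E-t46's `Joshi/Arithmeticoids2Model.lean` (p434058) instantiates the three tower
signatures of K. Joshi, arXiv:2305.10398 (bib `Joshi2023ATS2half`, unrefereed) §4.5 (`BRingDatum`, E-t37 p430897), §5.13 (`ResidueDatum`,
E-t46 p432956) and §5.1 (`TiltDatum`, E-t46 p432942) over E-t37's ONE-PLACE TOY; this file does the same over the ARITHMETIC base:
* `towerBRing L : (model L).BRingDatum (Loc L)` — `B_{L_v} := L_v` itself (`φ_v = 1`, `B⁺ = B`; HONEST-DEGENERATE: the Fargues–Fontaine ring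
  is replaced by its field of constants) with a GENUINE uniformiser `π_v ∈ L ⊂ L_v` at every finite place
  (`IsDedekindDomain.HeightOneSpectrum.valuation_exists_uniformizer`), `π_v = 1` at infinite `v`;
* `towerResidue L : (model L).ResidueDatum (towerBRing L)` — `η_{y_v} := id : L_v → K_{y_v} = L_v` (onto, continuous, kernel `{0}` closed in
  the Hausdorff valued topology);
* `towerTilt L : (model L).TiltDatum (fun v => ZMod (p_v)) (fun v _ => ZMod (p_v))` — the tilts `F_v = K^♭_{y_v} := 𝔽_{p_v}`, the PRIME FIELD
  of the residue characteristic (CharP `p_v` by instance, discrete topology, identity tilting isomorphisms; at infinite `v`, `p_v = 1` and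
  `ZMod 1` is the zero ring — the signature asks CharP only off `V^arc`). HONEST-DEGENERATE in the perfectoid direction: `𝔽_{p_v}` stands
  in for `ℂ^♭_{p_v}`; arithmetic in that the characteristic IS the residue characteristic of the place.
* VERDICTS at the arithmetic tower: Prop. 5.1.8 (`prop518`, by name), Thm. 5.13.1 (`thm5131` instantiates; `tower_Iy_eq_bot`: `I_y = 0`
  here), **Thm. 5.12.1 (2) topological clause `Thm5121_2_top` HOLDS with infinitely many arithmeticoids** (`tower_thm5121_2_top`: the
  embedded `L_v`'s are all of `K_{y_v} = L_v`, identity isomorphism — at the toy it held only because there is ONE arithmeticoid),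
  Prop. 5.15.1 (`Prop5151v2`) VACUOUS (`base = cp`; an honest test needs algebraically closed `K_{y_v}`, which this model does not have).
No side taken on [IUTchIII] Cor. 3.12 or on any author; typed ≠ proved; a model exhibits satisfiability, nothing more. [folklore] throughout;
`[claim: Joshi2023ATS2half, status: disputed]` tags only the quoted claim-`Prop`s.
-/

noncomputable section

open NumberField TopologicalSpace

namespace Summit.ABC.IUTFork.Joshi.ATS2h

namespace NumberFieldModel

variable (L : Type) [Field L] [NumberField L]

/-! ## 1. `BRingDatum`: `B_{L_v} := L_v`, genuine uniformisers -/

/-- A uniformiser of `L` at each place: at a finite place `w` an element `π_w ∈ L` of `w`-adic valuation `exp(−1)`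
(`valuation_exists_uniformizer`), at an infinite place `1`. [folklore] -/
def unif : (v : Place L) → Loc L v
  | Sum.inl _ => 1
  | Sum.inr w => toLoc L (Sum.inr w) (w.maximalIdeal.valuation_exists_uniformizer L).choose

/-- The chosen uniformiser has valuation `exp(−1)` at its place. [folklore] -/
theorem valuation_unif (w : FinitePlace L) :
    w.maximalIdeal.valuation L ((WithAbs.equiv _) (unif L (Sum.inr w))) = WithZero.exp (-1 : ℤ) :=
  (w.maximalIdeal.valuation_exists_uniformizer L).choose_spec

/-- **[J-2½] Def. 4.5.1's local rings, instantiated**: `B_{L_v} := L_v`, `B⁺ := B`, `ϕ_v := 1`, `π_v :=` a genuine uniformiser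
(`1` at `v ∈ V^arc`). HONEST-DEGENERATE (no Fargues–Fontaine ring). [folklore] -/
def towerBRing : (model L).BRingDatum (Loc L) where
  Bplus := fun _ => ⊤
  Bplus_arch := fun _ _ => rfl
  frobB := fun _ => RingHom.id _
  frobB_algebraMap := fun _ _ => rfl
  frobB_arch := fun _ _ => rfl
  unif := unif L
  unif_arch := fun v hv => by
    rcases v with w | w
    · rfl
    · exact (inr_notMem_arch L w hv).elim

/-- `BRingDatum` is inhabited over the arithmetic model. [folklore] -/
theorem towerBRing_nonempty : Nonempty ((model L).BRingDatum (Loc L)) := ⟨towerBRing L⟩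

/-! ## 2. `ResidueDatum`: `η_{y_v} := id` -/

/-- **[J-2½] §5.13's residue maps, instantiated**: `η_{y_v} := id : L_v → K_{y_v} = L_v` (onto, continuous; kernel `{0}`, closed since the
valued topology is Hausdorff). [folklore] -/
def towerResidue : (model L).ResidueDatum (towerBRing L) where
  eta := fun _ _ => RingHom.id _
  eta_surjective := fun _ _ => Function.surjective_id
  continuous_eta := fun _ _ => continuous_id
  isClosed_ker := fun v _ => by
    have : ((RingHom.ker (RingHom.id (Loc L v)) : Ideal (Loc L v)) : Set (Loc L v)) = {0} := by
      ext x
      simp [RingHom.mem_ker]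
    rw [this]
    exact isClosed_singleton

/-- `ResidueDatum` is inhabited over the arithmetic model. [folklore] -/
theorem towerResidue_nonempty : Nonempty ((model L).ResidueDatum (towerBRing L)) := ⟨towerResidue L⟩

/-- Thm. 5.13.1 at the arithmetic tower: `B_L ⧸ I_y ≃+* R_y` instantiates (E-t46's `ResidueDatum.thm5131`, by name). [folklore] -/
def tower_thm5131 (y : (model L).Arith) : (towerBRing L).BL ⧸ (towerResidue L).Iy y ≃+* (model L).arithRing y :=
  (towerResidue L).thm5131 y

/-- At the arithmetic tower `I_y = 0` (the residue maps are injective). [folklore] -/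
theorem tower_Iy_eq_bot (y : (model L).Arith) : (towerResidue L).Iy y = ⊥ := by
  ext b
  rw [(towerResidue L).mem_Iy_iff]
  simp only [Ideal.mem_bot, funext_iff]
  exact Iff.rfl

/-! ## 3. `TiltDatum`: tilts `:= 𝔽_{p_v}` -/

/-- **[J-2½] Def. 5.1.1 / 5.1.7's tilting data, instantiated**: `F_v = K^♭_{y_v} := ZMod (p_v) = 𝔽_{p_v}` (the prime field of the residue
characteristic; CharP `p_v` by instance, discrete topology), identity tilting isomorphisms. HONEST-DEGENERATE in the perfectoid direction.
[folklore] -/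
def towerTilt : (model L).TiltDatum (fun v => ZMod (resChar L v)) (fun v _ => ZMod (resChar L v)) where
  tiltIso := fun _ _ => RingEquiv.refl _
  continuous_tiltIso := fun _ _ => continuous_id
  continuous_tiltIso_symm := fun _ _ => continuous_id
  charP_nonarch := fun v _ _ => ZMod.charP (resChar L v)

/-- `TiltDatum` is inhabited over the arithmetic model. [folklore] -/
theorem towerTilt_nonempty :
    Nonempty ((model L).TiltDatum (fun v => ZMod (resChar L v)) (fun v _ => ZMod (resChar L v))) := ⟨towerTilt L⟩

/-- At a finite place the tilt factor has PRIME characteristic `p_v` and is a field (`𝔽_{p_v}`), so it is NOT of characteristic zero —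
the «unbounded residue characteristics» shape of E-t46's `tilt_charZero` discussion is contentful here too. [folklore] -/
theorem towerTilt_not_charZero (w : FinitePlace L) : ¬ CharZero (ZMod (resChar L (Sum.inr w))) := by
  haveI : Fact (resChar L (Sum.inr w)).Prime := ⟨resChar_prime L w⟩
  intro h
  have h0 : ((resChar L (Sum.inr w) : ℕ) : ZMod (resChar L (Sum.inr w))) = 0 := ZMod.natCast_self _
  exact (resChar_prime L w).ne_zero (Nat.cast_injective (R := ZMod (resChar L (Sum.inr w))) (by rw [h0, Nat.cast_zero]))

/-! ## 4. Verdicts at the arithmetic tower -/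

/-- [J-2½] Prop. 5.1.8 at the arithmetic tower (E-t46's `TiltDatum.prop518`, by name): all tilts `R^♭_y = ∏_v 𝔽_{p_v}` are the same
topological ring. [claim: Joshi2023ATS2half, status: disputed] -/
theorem tower_prop518 (y₁ y₂ : (model L).Arith) :
    ∃ e : (towerTilt L).tilt y₁ ≃+* (towerTilt L).tilt y₂, Continuous e ∧ Continuous e.symm :=
  (towerTilt L).prop518 y₁ y₂

/-- **[J-2½] Thm. 5.12.1 (2), topological clause (`Thm5121_2_top`) HOLDS at the arithmetic model** — with INFINITELY MANY arithmeticoids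
(`Arith = ∏_v ℤ`): the embedded local fields `L_{i,v} = ι_{y_v}(L_v)` are all of `K_{y_v} = L_v` (`ι = id`), so the identity is a bi-continuous
isomorphism `L_{1,v} ≃ L_{2,v}`. (At the toy p434058 this held only because there is ONE arithmeticoid.) [claim: Joshi2023ATS2half, status: disputed] -/
theorem tower_thm5121_2_top : (model L).Thm5121_2_top := fun _ _ _ =>
  ⟨RingEquiv.refl _, continuous_id, continuous_id⟩

/-- The model has infinitely many arithmeticoids (so `tower_thm5121_2_top` is not the one-point triviality). [folklore] -/
theorem arith_infinite : Infinite (model L).Arith := by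
  obtain ⟨u⟩ : Nonempty (InfinitePlace L) := inferInstance
  exact Infinite.of_injective (fun n : ℤ => fun _ => n) fun a b h => by simpa using congrFun h (Sum.inl u)

/-- [J-2½] Prop. 5.15.1 (`Prop5151v2`) is VACUOUS at the arithmetic model (`base = cp`, not Def. 4.1.1's `𝒴_L`); an honest test of its
content («value group of `K_{y_v}` = the ℚ-hull of that of `L_v`») needs algebraically closed `K_{y_v}`, which this model lacks — said, not
tested. [claim: Joshi2023ATS2half, status: disputed] -/
theorem tower_prop5151v2 : (model L).Prop5151v2 := fun h => by
  simp [DeformationDatum.IsDef411, model] at h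

end NumberFieldModel

end Summit.ABC.IUTFork.Joshi.ATS2h

end
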